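import Summits.Ventures.CertifiedManyBodySolver.Downfold.EmeryOrbitalWeightAxisBox
import HarnessLib

/-!
# THE FERMI-ENERGY SLOPE LAW, step one: raising `Δ` by `δ` lowers the antibonding band at `k` by AT LEAST `κδ` for every `κ` below the oxygen weight `1 − w_d` of the state
# (a Hellmann–Feynman bound WITHOUT derivatives — one cubic identity; INFL-3to1-B §B.90 (i), successor device for the antinodal window of the (K) cuprate boxes)

Venture CertifiedManyBodySolver, cell `pub/hubbard-downfold` (stage S1; INFLATION-RULES-3to1-B §B.83 (`EmeryChargeTransferLipschitz`: `ε_AB(Δ) − δ ≤ ε_AB(Δ + δ) ≤ ε_AB(Δ)`,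
the slope of the band in `Δ` lies in `[−1, 0]`), §B.90 (h) (the antinodal-window device «fixed-energy lever ∘ energy lever» stops at `Δ + ε = 4(t_pp + t_pp′)`, where the typed (K)
cuprate boxes sit; a FIXED-FILLING lever needs a NEGATIVE UPPER bound on the slope)), seat hubbard-downfold-mod-4 (technique B, g38); namespace
`Summit.Ventures.CertifiedManyBodySolver.Downfold.Emery`. Everything PROVED (0 sorry; one `ring` identity + the sign structure of the secular cubic).
WHAT THIS IS NOT: a statement about any material; `U = 0` one-body kinematics of the σ (d–pₓ–p_y + t_pp + t_pp′) model.

THE IDENTITY (`charCubic_slope_identity`). With `Δ′ = Δ + δ`, `E′` ANY energy, `q′ = ∂_ε charCubic(Δ′; E′)`, `m′ = minorD(Δ′; E′)`, `A′ = cubA(Δ′) = 2Δ′ + 4t_pp′(x + y)`: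
`charCubic(Δ; E′ + κδ) = charCubic(Δ′; E′) + δ·slopeT`, `slopeT = m′ − (1 − κ)q′ + δ(1 − κ)[(1 − κ)(3E′ + A′) − (2E′ + A′)] + κ(1 − κ)²δ²`.
At `E′ = ε_AB(Δ′; k)` the first term vanishes and `m′ = w′·q′` (`w′` = the Cu-d weight of the state), so to FIRST order `slopeT = −q′·(1 − κ − w′)`: the band at `Δ` lies above
`E′ + κδ` as soon as `κ < 1 − w′` and `δ` is small against the margin — **`ε_AB(Δ + δ; k) ≤ ε_AB(Δ; k) − κδ`** (`abBand_shift_le_sub_of_slopeT_nonpos`; user form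
`abBand_shift_le_sub`: `δ(E′ + δ) ≤ 2(1 − κ − w̄)E′²` with `w′ ≤ w̄`, using `q′ ≥ E′(2E′ + A′)` from `charCubic(Δ′; 0) ≤ 0`). The weight bound `w̄` may be taken as the axis
ceiling `dWeightAxisCF` of `EmeryOrbitalWeightAxisBox` (`abBand_shift_le_sub_axis`). Iterating the step (telescoping, each step small) gives the slope law for finite `δ`
with the sole condition `κ < 1 − w̄` — sequel.

Sources: three-band model [HybertsenSchluterChristensen1989, Eq. (1)]; Hellmann–Feynman / first-order perturbation theory [folklore]; [folklore] algebra.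
-/

noncomputable section

namespace Summit.Ventures.CertifiedManyBodySolver.Downfold.Emery

open Real Set

/-! ## §1 The slope polynomial and the identity -/

/-- `slopeT Δ′ a b c x y E′ δ κ = m′ − (1 − κ)q′ + δ(1 − κ)[(1 − κ)(3E′ + A′) − (2E′ + A′)] + κ(1 − κ)²δ²` (`q′ = dcharCubic`, `m′ = minorD`, `A′ = cubA`, all at the
SHIFTED row `Δ′` and the energy `E′`). [folklore] -/
def slopeT (Δ' a b c x y E' δ κ : ℝ) : ℝ :=
  minorD Δ' b c x y E' - (1 - κ) * dcharCubic Δ' a b c x y E' +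
    δ * (1 - κ) * ((1 - κ) * (3 * E' + cubA Δ' c x y) - (2 * E' + cubA Δ' c x y)) + κ * (1 - κ) ^ 2 * δ ^ 2

/-- **THE SLOPE IDENTITY**: `charCubic(Δ; E′ + κδ) = charCubic(Δ + δ; E′) + δ·slopeT(Δ + δ; E′, δ, κ)` for ALL reals. [folklore] -/
theorem charCubic_slope_identity (Δ a b c x y E' δ κ : ℝ) :
    charCubic Δ a b c x y (E' + κ * δ) = charCubic (Δ + δ) a b c x y E' + δ * slopeT (Δ + δ) a b c x y E' δ κ := by
  unfold slopeT charCubic minorD dcharCubic dcA dfsD dfsN cubA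
  ring

/-- `charCubic(Δ′; 0) = charCubic(Δ′; E′) − E′q′ + E′²(3E′ + A′) − E′³` (Taylor at `E′` down to `0`). [folklore] -/
theorem charCubic_zero_taylor (Δ' a b c x y E' : ℝ) :
    charCubic Δ' a b c x y 0 = charCubic Δ' a b c x y E' - E' * dcharCubic Δ' a b c x y E' + E' ^ 2 * (3 * E' + cubA Δ' c x y) - E' ^ 3 := by
  unfold charCubic dcharCubic dcA dfsD dfsN cubA
  ring

/-- **Lower bound on the energy derivative at the band**: `q′ = ∂_ε charCubic(Δ′; ε_AB) ≥ ε_AB·(2ε_AB + A′)` when `ε_AB > 0` (from `charCubic(Δ′; 0) ≤ 0`;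
`Δ′, t_pp, t_pp′, x, y ≥ 0`). [folklore] -/
theorem dcharCubic_abBand_ge {Δ' a b c x y : ℝ} (hΔ : 0 ≤ Δ') (hc : 0 ≤ c) (hb : 0 ≤ b) (hx : 0 ≤ x) (hy : 0 ≤ y) (hE : 0 < abBand Δ' a b c x y) :
    abBand Δ' a b c x y * (2 * abBand Δ' a b c x y + cubA Δ' c x y) ≤ dcharCubic Δ' a b c x y (abBand Δ' a b c x y) := by
  set E := abBand Δ' a b c x y with hEdef
  have h0 := charCubic_zero_nonpos (a := a) hΔ hc hb hx hy
  have ht := charCubic_zero_taylor Δ' a b c x y E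
  rw [charCubic_abBand] at ht
  -- 0 ≥ −E q′ + E²(3E + A′) − E³ = E·(E(2E + A′) − q′)
  have h1 : E * (E * (2 * E + cubA Δ' c x y) - dcharCubic Δ' a b c x y E) ≤ 0 := by nlinarith
  by_contra hlt
  push Not at hlt
  have : 0 < E * (E * (2 * E + cubA Δ' c x y) - dcharCubic Δ' a b c x y E) := mul_pos hE (by linarith)
  linarith

/-! ## §2 The one-step slope law -/

/-- **ONE STEP, exact form**: if `slopeT(Δ + δ; ε_AB(Δ + δ; k), δ, κ) ≤ 0` then `ε_AB(Δ + δ; k) + κδ ≤ ε_AB(Δ; k)` (the cubic of row `Δ` is non-positive at `ε_AB(Δ + δ) + κδ`,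
hence that energy is not above the top root). [folklore] -/
theorem abBand_shift_le_sub_of_slopeT_nonpos {Δ a b c x y δ κ : ℝ} (hδ : 0 ≤ δ)
    (hT : slopeT (Δ + δ) a b c x y (abBand (Δ + δ) a b c x y) δ κ ≤ 0) :
    abBand (Δ + δ) a b c x y + κ * δ ≤ abBand Δ a b c x y := by
  by_contra hlt
  push Not at hlt
  have hpos := charCubic_pos_of_abBand_lt hlt
  rw [charCubic_slope_identity, charCubic_abBand, zero_add] at hpos
  have : δ * slopeT (Δ + δ) a b c x y (abBand (Δ + δ) a b c x y) δ κ ≤ 0 := mul_nonpos_of_nonneg_of_nonpos hδ hT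
  linarith

/-- `slopeT ≤ −q′(1 − κ − w′) + δ(1 − κ)E′ + κδ²` at the band energy (`w′ = m′/q′` the Cu-d weight of the state; `0 ≤ κ ≤ 1`, `E′, A′ ≥ 0`, `q′ > 0`). [folklore] -/
theorem slopeT_le {Δ' a b c x y E' δ κ : ℝ} (hκ0 : 0 ≤ κ) (hκ1 : κ ≤ 1) (hδ : 0 ≤ δ) (hE : 0 ≤ E') (hA : 0 ≤ cubA Δ' c x y)
    (hq : 0 < dcharCubic Δ' a b c x y E') :
    slopeT Δ' a b c x y E' δ κ ≤
      -(dcharCubic Δ' a b c x y E') * (1 - κ - minorD Δ' b c x y E' / dcharCubic Δ' a b c x y E') + δ * (1 - κ) * E' + κ * δ ^ 2 := by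
  unfold slopeT
  have e1 : -(dcharCubic Δ' a b c x y E') * (1 - κ - minorD Δ' b c x y E' / dcharCubic Δ' a b c x y E') =
      minorD Δ' b c x y E' - (1 - κ) * dcharCubic Δ' a b c x y E' := by
    field_simp
    ring
  rw [e1]
  have h2 : (1 - κ) * (3 * E' + cubA Δ' c x y) - (2 * E' + cubA Δ' c x y) ≤ E' := by nlinarith
  have h3 : δ * (1 - κ) * ((1 - κ) * (3 * E' + cubA Δ' c x y) - (2 * E' + cubA Δ' c x y)) ≤ δ * (1 - κ) * E' :=
    mul_le_mul_of_nonneg_left h2 (mul_nonneg hδ (by linarith))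
  have h4 : κ * (1 - κ) ^ 2 * δ ^ 2 ≤ κ * δ ^ 2 := by
    have : (1 - κ) ^ 2 ≤ 1 := by nlinarith
    nlinarith [mul_nonneg hκ0 (sq_nonneg δ)]
  linarith

/-- **ONE STEP, user form — THE HELLMANN–FEYNMAN SLOPE BOUND WITHOUT DERIVATIVES.** Row `(Δ, a, b, c)` with `Δ ≥ 0`, `0 ≤ c ≤ b`, `b > 0`, `a ≠ 0`, zone point `(x, y) ∈ [0, 1]²`
with `x + y > 0`; shift `δ ≥ 0`, rate `0 ≤ κ ≤ 1`; let `E′ = ε_AB(Δ + δ; x, y)` and let `w̄` bound the Cu-d weight of that state (`dWeight(Δ + δ; x, y; E′) ≤ w̄`). If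
**`δ(E′ + δ) ≤ 2(1 − κ − w̄)E′²`** then **`ε_AB(Δ + δ; x, y) ≤ ε_AB(Δ; x, y) − κδ`**. To first order in `δ` the condition is `κ < 1 − w′`: the band moves down at least as fast
as its OXYGEN weight — the content of `∂ε_k/∂Δ = −(1 − w_d(k))`. [folklore] -/
theorem abBand_shift_le_sub {Δ a b c x y δ κ wbar : ℝ} (hΔ : 0 ≤ Δ) (hc : 0 ≤ c) (hb : 0 ≤ b) (hx : 0 ≤ x) (hy : 0 ≤ y) (hδ : 0 ≤ δ) (hκ0 : 0 ≤ κ)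
    (hκ1 : κ ≤ 1) (hw : dWeight (Δ + δ) a b c x y (abBand (Δ + δ) a b c x y) ≤ wbar)
    (hstep : δ * (abBand (Δ + δ) a b c x y + δ) ≤ 2 * (1 - κ - wbar) * abBand (Δ + δ) a b c x y ^ 2) :
    abBand (Δ + δ) a b c x y + κ * δ ≤ abBand Δ a b c x y := by
  rcases eq_or_lt_of_le hδ with hδ0 | hδpos
  · rw [← hδ0]; simp
  have hΔ' : 0 ≤ Δ + δ := by linarith
  set E := abBand (Δ + δ) a b c x y with hE
  have hE0 : 0 ≤ E := abBand_nonneg hΔ' hc hb hx hy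
  -- E > 0: otherwise hstep reads δ² ≤ 0
  have hEpos : 0 < E := by
    by_contra hle
    have hEz : E = 0 := le_antisymm (not_lt.1 hle) hE0
    rw [hEz] at hstep
    nlinarith
  have hA : 0 ≤ cubA (Δ + δ) c x y := by unfold cubA; positivity
  have hq := dcharCubic_abBand_ge (a := a) (b := b) hΔ' hc hb hx hy hEpos
  rw [← hE] at hq
  have hqpos : 0 < dcharCubic (Δ + δ) a b c x y E := lt_of_lt_of_le (by positivity) hq
  -- the margin 1 − κ − w̄ is non-negative (else hstep is impossible)
  have hmar : 0 ≤ 1 - κ - wbar := by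
    by_contra hneg
    push Not at hneg
    have : 2 * (1 - κ - wbar) * E ^ 2 < 0 := by nlinarith [sq_nonneg E, hEpos]
    nlinarith
  have hw' : minorD (Δ + δ) b c x y E / dcharCubic (Δ + δ) a b c x y E ≤ wbar := by
    rw [← dWeight_eq_div_dcharCubic]; exact hw
  have hT1 := slopeT_le (Δ' := Δ + δ) (a := a) (b := b) (c := c) (x := x) (y := y) hκ0 hκ1 hδ hE0 hA hqpos
  have hmq : minorD (Δ + δ) b c x y E ≤ wbar * dcharCubic (Δ + δ) a b c x y E := (div_le_iff₀ hqpos).1 hw'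
  have e2 : -(dcharCubic (Δ + δ) a b c x y E) * (1 - κ - minorD (Δ + δ) b c x y E / dcharCubic (Δ + δ) a b c x y E) =
      -(dcharCubic (Δ + δ) a b c x y E) * (1 - κ) + minorD (Δ + δ) b c x y E := by
    field_simp
    ring
  have h2 : -(dcharCubic (Δ + δ) a b c x y E) * (1 - κ - minorD (Δ + δ) b c x y E / dcharCubic (Δ + δ) a b c x y E) ≤
      -(dcharCubic (Δ + δ) a b c x y E) * (1 - κ - wbar) := by rw [e2]; nlinarith
  have h3 : -(dcharCubic (Δ + δ) a b c x y E) * (1 - κ - wbar) ≤ -(E * (2 * E + cubA (Δ + δ) c x y)) * (1 - κ - wbar) := by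
    have := mul_le_mul_of_nonneg_right hq hmar
    linarith
  have h4 : -(E * (2 * E + cubA (Δ + δ) c x y)) * (1 - κ - wbar) ≤ -(2 * E ^ 2) * (1 - κ - wbar) := by
    nlinarith [mul_nonneg (mul_nonneg hE0 hA) hmar]
  have h5 : δ * (1 - κ) * E ≤ δ * E := by nlinarith [mul_nonneg (mul_nonneg hδ hκ0) hE0]
  have h6 : κ * δ ^ 2 ≤ δ ^ 2 := by nlinarith [sq_nonneg δ]
  apply abBand_shift_le_sub_of_slopeT_nonpos hδ
  rw [← hE]
  nlinarith

/-- **ONE STEP with the axis ceiling as the weight bound**: the Cu-d weight of any antibonding state at energy `E′ > 0` is at most `w_axis(Δ′; E′) = dWeightAxisCF(Δ′, a, c; E′)`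
(`EmeryOrbitalWeightAxis`), so `δ(E′ + δ) ≤ 2(1 − κ − dWeightAxisCF(Δ + δ, a, c; E′))E′²` suffices (`0 ≤ c ≤ b`, `b > 0`, `a ≠ 0`, `t_pp′E′ < a²`). [folklore] -/
theorem abBand_shift_le_sub_axis {Δ a b c x y δ κ : ℝ} (hΔ : 0 ≤ Δ) (hc : 0 ≤ c) (hcb : c ≤ b) (hb : 0 < b) (ha : a ≠ 0) (hx : x ∈ Icc (0 : ℝ) 1)
    (hy : y ∈ Icc (0 : ℝ) 1) (hδ : 0 ≤ δ) (hκ0 : 0 ≤ κ) (hκ1 : κ ≤ 1) (hE : 0 < abBand (Δ + δ) a b c x y) (hm : c * abBand (Δ + δ) a b c x y < a ^ 2)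
    (hstep : δ * (abBand (Δ + δ) a b c x y + δ) ≤ 2 * (1 - κ - dWeightAxisCF (Δ + δ) a c (abBand (Δ + δ) a b c x y)) * abBand (Δ + δ) a b c x y ^ 2) :
    abBand (Δ + δ) a b c x y + κ * δ ≤ abBand Δ a b c x y := by
  have hΔ' : 0 ≤ Δ + δ := by linarith
  have hw := (dWeight_mem_Icc_node_axis hΔ' hc hcb hb ha hE hm hx hy (charCubic_abBand (Δ + δ) a b c x y)).2.2
  rw [dWeightAxis_eq_CF (by linarith) hE ha hm] at hw
  exact abBand_shift_le_sub hΔ hc hb.le hx.1 hy.1 hδ hκ0 hκ1 hw hstep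

end Summit.Ventures.CertifiedManyBodySolver.Downfold.Emery
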